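import Mathlib
import HarnessLib
import Summits.Ventures.LatticeQCDFlow.Exactness.SU2LeapfrogHMCErgodic
import Summits.Ventures.LatticeQCDFlow.Exactness.TransformedKernelConvergence

/-!
# Field-transformed single-step leapfrog HMC on `SU(2)` lattice gauge fields is uniformly ergodic: Doeblin minorants survive reporting through the map

HONEST FRAMING: exact (Metropolis-corrected) sampling algorithms for lattice gauge theory;
figures of merit are autocorrelation/cost numbers at stated couplings and volumes; no
continuum-physics claim.

Venture `LatticeQCDFlow` (cell pub-lqcd), topic `Exactness`, FANOUT row 9 (eng-latcore; the
kernels concerned are `latflow.core.hmc` and family B's `latflow.fthmc` — trivializing-map /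
field-transformed HMC, Lüscher 2010: run HMC for `H̃(V, π) = S(F V) − log J(V) + T(π)` and REPORT
`U = F V`).  NEW WORK of the cell over the tree (`SU2LeapfrogHMCErgodic.lean`: Doeblin + uniform
ergodicity of single-step leapfrog HMC on `SU(2)^ι` for ANY bounded measurable action;
`TransformedKernel.lean` / `MomentumRefresh.lean`: `conjKernel`, `thmc_config_exact`; row 7's
`TransformedKernelConvergence.lean`: `conjKernel_minorised`; `RefreshScan.lean` /
`DoeblinUniqueness.lean`); nothing here is cited as a fact.  Printed
counterparts, named only: Lüscher 2010 (trivializing maps), Duane–Kennedy–Pendleton–Roweth 1987.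

THE POINT.  A Doeblin minorant is a statement about ONE step from EVERY state, so it passes
through any measurable re-labelling of the state space: if `K(v, ·) ≥ δ·π₀` for all `v` then the
reported kernel `F ∘ K ∘ F⁻¹` dominates `δ·F_*π₀` from every `x` (row 7's
`TransformedKernelConvergence.conjKernel_minorised`, reused, not restated).  The
modified action `S∘F − log J` of FT-HMC is bounded and measurable as soon as `S` is and the
Jacobian `J` is pinched between two positive constants (`abs_transformedAction_le`) — so
`SU2LeapfrogHMCErgodic.su2LeapfrogHMC_minorised` applies to the `V`-chain verbatim, and the reported
`U`-chain inherits the minorant, while `thmc_config_exact` says its invariant law is `e^{−S}·Haar^{⊗ι}`: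

* `su2LeapfrogFTHMC_invariant` — the reported single-step leapfrog FT-HMC kernel on `SU(2)^ι`
  leaves `e^{−S}·Haar^{⊗ι}` invariant (`thmc_config_exact` with the Liouville / time-reversal facts
  of `SU2LeapfrogHMC.lean`), and `su2LeapfrogFTHMC_invariant_gibbsLaw` (the normalised law);
* **`su2LeapfrogFTHMC_uniformlyErgodic`** — for every measurable equivalence `F` of `SU(2)^ι` with
  `HasJacobian Haar^{⊗ι} F J`, `0 < j₁ ≤ J ≤ j₂` measurable, every measurable action `|S| ≤ s`,
  measurable momentum increment `|g| ≤ b`, `ε, κ > 0`: there is `δ ∈ (0, 1]` with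
  `|μ₀K̃ᵗ(A) − π_S(A)| ≤ (1 − δ)ᵗ` for EVERY initial law `μ₀`, every `t`, every `A`
  (`π_S = Z_S⁻¹e^{−S}·Haar^{⊗ι}`, `K̃` the reported FT-HMC kernel);
* **`su2LeapfrogFTHMC_invariant_unique`** — `π_S` is the only invariant probability law of `K̃`.

NOT CLAIMED: `nstep ≥ 2`, OMF words, `tau_jitter`, `SU(N ≥ 3)`, any useful rate, floating point
(as in `SU2LeapfrogHMCErgodic.lean`); which members `F` the engine certifies (row 14's
`SU2WilsonFlowLOMember.lean` types the masked `SU(2)` Wilson-flow sub-step with a certified positive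
CONTINUOUS Jacobian on the compact configuration space — pinched as required — in its own momentum
coordinates; the identification of those coordinates with the Pauli chart used here is not made).
-/

noncomputable section

namespace Summit.Ventures.LatticeQCDFlow.Exactness

open MeasureTheory ProbabilityTheory ProbabilityTheory.Kernel Set
open Literature.MathematicalPhysics.QuantumFieldTheory (haarProbability)
open scoped ENNReal

/-! ## FT-HMC on `SU(2)^ι`: the modified action is bounded, the reported chain is Doeblin -/

section FTHMC

variable {ι : Type*} [Fintype ι] {ε κ : ℝ}
  {g : (ι → Matrix.specialUnitaryGroup (Fin 2) ℂ) → ι → EuclideanSpace ℝ (Fin 3)}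
  {S : (ι → Matrix.specialUnitaryGroup (Fin 2) ℂ) → ℝ} {s : ℝ}
  {F : (ι → Matrix.specialUnitaryGroup (Fin 2) ℂ) ≃ᵐ (ι → Matrix.specialUnitaryGroup (Fin 2) ℂ)}
  {J : (ι → Matrix.specialUnitaryGroup (Fin 2) ℂ) → ℝ} {j₁ j₂ : ℝ}

omit [Fintype ι] in
/-- **The modified action `S∘F − log J` is bounded** when `|S| ≤ s` and `0 < j₁ ≤ J ≤ j₂`:
`|S(F v) − log J(v)| ≤ s + (|log j₁| + |log j₂|)`. -/
theorem abs_transformedAction_le (hs : ∀ u, |S u| ≤ s) (hj₁ : 0 < j₁) (hJ₁ : ∀ v, j₁ ≤ J v)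
    (hJ₂ : ∀ v, J v ≤ j₂) (v : ι → Matrix.specialUnitaryGroup (Fin 2) ℂ) :
    |S (F v) - Real.log (J v)| ≤ s + (|Real.log j₁| + |Real.log j₂|) := by
  have hJpos : 0 < J v := hj₁.trans_le (hJ₁ v)
  have hlo : Real.log j₁ ≤ Real.log (J v) := Real.log_le_log hj₁ (hJ₁ v)
  have hhi : Real.log (J v) ≤ Real.log j₂ := Real.log_le_log hJpos (hJ₂ v)
  have hlog : |Real.log (J v)| ≤ |Real.log j₁| + |Real.log j₂| := by
    rcases le_or_gt 0 (Real.log (J v)) with h | h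
    · rw [abs_of_nonneg h]
      exact (hhi.trans (le_abs_self _)).trans (le_add_of_nonneg_left (abs_nonneg _))
    · rw [abs_of_neg h]
      exact ((neg_le_neg hlo).trans (neg_le_abs _)).trans (le_add_of_nonneg_right (abs_nonneg _))
  calc |S (F v) - Real.log (J v)| ≤ |S (F v)| + |Real.log (J v)| := abs_sub _ _
    _ ≤ s + (|Real.log j₁| + |Real.log j₂|) := add_le_add (hs _) hlog

omit [Fintype ι] in
/-- The modified action is measurable. -/
theorem measurable_transformedAction (hS : Measurable S) (hJm : Measurable J) :
    Measurable fun v : ι → Matrix.specialUnitaryGroup (Fin 2) ℂ => S (F v) - Real.log (J v) :=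
  (hS.comp F.measurable).sub (Real.measurable_log.comp hJm)

/-- **The reported FT-HMC kernel is exact**: single-step leapfrog HMC for the modified action
`S∘F − log J` on the `V`-variables, reported through `F`, leaves `e^{−S}·Haar^{⊗ι}` invariant
(`thmc_config_exact`). -/
theorem su2LeapfrogFTHMC_invariant (hκ : 0 < κ) (hg : Measurable g) (hJ : ∀ v, 0 < J v)
    (hJm : Measurable J)
    (hF : HasJacobian (Measure.pi fun _ : ι => haarProbability (Matrix.specialUnitaryGroup (Fin 2) ℂ)) F
      fun v => ENNReal.ofReal (J v))
    (hS : Measurable S) :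
    Invariant (conjKernel (su2LeapfrogHMC ε κ hg fun v => S (F v) - Real.log (J v)) F)
      ((Measure.pi fun _ : ι => haarProbability (Matrix.specialUnitaryGroup (Fin 2) ℂ)).withDensity
        fun u => ENNReal.ofReal (Real.exp (-S u))) :=
  thmc_config_exact (vol := Measure.pi fun _ : ι => haarProbability (Matrix.specialUnitaryGroup (Fin 2) ℂ))
    (volP := volume) (hΦ := measurable_su2LeapfrogProposal ε hg) hJ hJm hF hS (measurable_su2Kinetic κ)
    (involutive_su2LeapfrogProposal ε) (measurePreserving_su2LeapfrogProposal ε hg)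
    (su2MomentumWeight_univ_ne_zero hκ) (su2MomentumWeight_univ_ne_top hκ)

/-- … and the normalised Gibbs law `π_S = Z_S⁻¹e^{−S}·Haar^{⊗ι}` is invariant. -/
theorem su2LeapfrogFTHMC_invariant_gibbsLaw (hκ : 0 < κ) (hg : Measurable g) (hJ : ∀ v, 0 < J v)
    (hJm : Measurable J)
    (hF : HasJacobian (Measure.pi fun _ : ι => haarProbability (Matrix.specialUnitaryGroup (Fin 2) ℂ)) F
      fun v => ENNReal.ofReal (J v))
    (hS : Measurable S) :
    Invariant (conjKernel (su2LeapfrogHMC ε κ hg fun v => S (F v) - Real.log (J v)) F) (su2GibbsLaw S) :=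
  invariant_smul (su2LeapfrogFTHMC_invariant hκ hg hJ hJm hF hS) _

/-- **FIELD-TRANSFORMED SINGLE-STEP LEAPFROG HMC ON `SU(2)^ι` IS UNIFORMLY ERGODIC.**  `F` a
measurable equivalence of the configuration space with `HasJacobian Haar^{⊗ι} F J`, `J` measurable
with `0 < j₁ ≤ J ≤ j₂`; `S` measurable with `|S| ≤ s`; momentum increment `g` measurable with
`|g| ≤ b`, `b ≥ 0`; `ε, κ > 0`.  Then there is `δ ∈ (0, 1]` such that the REPORTED chain satisfies
`|μ₀K̃ᵗ(A) − π_S(A)| ≤ (1 − δ)ᵗ` for every initial law `μ₀`, every `t`, every set `A`. -/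
theorem su2LeapfrogFTHMC_uniformlyErgodic (hε : 0 < ε) (hκ : 0 < κ) (hg : Measurable g) {b : ℝ}
    (hb0 : 0 ≤ b) (hb : ∀ u l, ‖g u l‖ ≤ b) (hS : Measurable S) (hs : ∀ u, |S u| ≤ s)
    (hj₁ : 0 < j₁) (hJ₁ : ∀ v, j₁ ≤ J v) (hJ₂ : ∀ v, J v ≤ j₂) (hJm : Measurable J)
    (hF : HasJacobian (Measure.pi fun _ : ι => haarProbability (Matrix.specialUnitaryGroup (Fin 2) ℂ)) F
      fun v => ENNReal.ofReal (J v)) :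
    ∃ δ : ℝ, 0 < δ ∧ δ ≤ 1 ∧ ∀ (μ₀ : Measure (ι → Matrix.specialUnitaryGroup (Fin 2) ℂ))
      [IsProbabilityMeasure μ₀] (t : ℕ) (A : Set (ι → Matrix.specialUnitaryGroup (Fin 2) ℂ)),
      |((fun m : Measure (ι → Matrix.specialUnitaryGroup (Fin 2) ℂ) =>
            m.bind (conjKernel (su2LeapfrogHMC ε κ hg fun v => S (F v) - Real.log (J v)) F))^[t] μ₀).real A
          - (su2GibbsLaw S).real A| ≤ (1 - δ) ^ t := by
  haveI : Fact (0 < κ) := ⟨hκ⟩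
  haveI := isProbabilityMeasure_su2GibbsLaw (ι := ι) hs
  have hJ : ∀ v, 0 < J v := fun v => hj₁.trans_le (hJ₁ v)
  have hSt : Measurable fun v : ι → Matrix.specialUnitaryGroup (Fin 2) ℂ => S (F v) - Real.log (J v) :=
    measurable_transformedAction hS hJm
  obtain ⟨δ, hδ0, hmin⟩ := su2LeapfrogHMC_minorised hε hκ hg hb0 hb hSt
    (abs_transformedAction_le hs hj₁ hJ₁ hJ₂)
  have hmin' := fun x => conjKernel_minorised hmin F x
  have hH : Measurable fun z : (ι → Matrix.specialUnitaryGroup (Fin 2) ℂ) × (ι → EuclideanSpace ℝ (Fin 3)) =>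
      (S (F z.1) - Real.log (J z.1)) + su2Kinetic κ z.2 :=
    (hSt.comp measurable_fst).add ((measurable_su2Kinetic κ).comp measurable_snd)
  haveI : Fact (Measurable fun z : (ι → Matrix.specialUnitaryGroup (Fin 2) ℂ) × (ι → EuclideanSpace ℝ (Fin 3)) =>
      (S (F z.1) - Real.log (J z.1)) + su2Kinetic κ z.2) := ⟨hH⟩
  haveI : IsMarkovKernel (su2LeapfrogHMC ε κ hg fun v => S (F v) - Real.log (J v)) := by
    unfold su2LeapfrogHMC; infer_instance
  haveI : IsProbabilityMeasure ((Measure.pi fun _ : ι =>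
      haarProbability (Matrix.specialUnitaryGroup (Fin 2) ℂ)).map F) :=
    Measure.isProbabilityMeasure_map F.measurable.aemeasurable
  have hδ1 : δ ≤ 1 := by
    have h := Measure.le_iff'.1 (hmin fun _ => 1) univ
    rwa [Measure.smul_apply, smul_eq_mul, measure_univ, measure_univ, mul_one] at h
  have hδtop : δ ≠ ⊤ := ne_top_of_le_ne_top ENNReal.one_ne_top hδ1
  refine ⟨δ.toReal, ENNReal.toReal_pos hδ0.ne' hδtop,
    ENNReal.toReal_le_of_le_ofReal zero_le_one (by rwa [ENNReal.ofReal_one]), fun μ₀ _ t A => ?_⟩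
  exact uniformlyErgodic_of_minorised hmin' (su2LeapfrogFTHMC_invariant_gibbsLaw hκ hg hJ hJm hF hS) μ₀ t A

/-- **The Gibbs law is the unique invariant probability law of the reported FT-HMC kernel** (same
hypotheses). -/
theorem su2LeapfrogFTHMC_invariant_unique (hε : 0 < ε) (hκ : 0 < κ) (hg : Measurable g) {b : ℝ}
    (hb0 : 0 ≤ b) (hb : ∀ u l, ‖g u l‖ ≤ b) (hS : Measurable S) (hs : ∀ u, |S u| ≤ s)
    (hj₁ : 0 < j₁) (hJ₁ : ∀ v, j₁ ≤ J v) (hJ₂ : ∀ v, J v ≤ j₂) (hJm : Measurable J)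
    (hF : HasJacobian (Measure.pi fun _ : ι => haarProbability (Matrix.specialUnitaryGroup (Fin 2) ℂ)) F
      fun v => ENNReal.ofReal (J v))
    {π' : Measure (ι → Matrix.specialUnitaryGroup (Fin 2) ℂ)} [IsProbabilityMeasure π']
    (hπ' : Invariant (conjKernel (su2LeapfrogHMC ε κ hg fun v => S (F v) - Real.log (J v)) F) π') :
    π' = su2GibbsLaw S := by
  haveI : Fact (0 < κ) := ⟨hκ⟩
  haveI := isProbabilityMeasure_su2GibbsLaw (ι := ι) hs
  have hJ : ∀ v, 0 < J v := fun v => hj₁.trans_le (hJ₁ v)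
  have hSt : Measurable fun v : ι → Matrix.specialUnitaryGroup (Fin 2) ℂ => S (F v) - Real.log (J v) :=
    measurable_transformedAction hS hJm
  obtain ⟨δ, hδ0, hmin⟩ := su2LeapfrogHMC_minorised hε hκ hg hb0 hb hSt
    (abs_transformedAction_le hs hj₁ hJ₁ hJ₂)
  have hmin' := fun x => conjKernel_minorised hmin F x
  haveI : Fact (Measurable fun z : (ι → Matrix.specialUnitaryGroup (Fin 2) ℂ) × (ι → EuclideanSpace ℝ (Fin 3)) =>
      (S (F z.1) - Real.log (J z.1)) + su2Kinetic κ z.2) :=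
    ⟨(hSt.comp measurable_fst).add ((measurable_su2Kinetic κ).comp measurable_snd)⟩
  haveI : IsMarkovKernel (su2LeapfrogHMC ε κ hg fun v => S (F v) - Real.log (J v)) := by
    unfold su2LeapfrogHMC; infer_instance
  haveI : IsProbabilityMeasure ((Measure.pi fun _ : ι =>
      haarProbability (Matrix.specialUnitaryGroup (Fin 2) ℂ)).map F) :=
    Measure.isProbabilityMeasure_map F.measurable.aemeasurable
  exact invariant_unique_of_minorised hmin' hδ0 (su2LeapfrogFTHMC_invariant_gibbsLaw hκ hg hJ hJm hF hS) hπ'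

end FTHMC

end Summit.Ventures.LatticeQCDFlow.Exactness
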